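import Summits.CriticalPhenomena.PercolationContinuityZ3.Theorems.PercNearOneGluingNoHeavyLowerTailSahiSunflowerSun4CertA
import Mathlib.Tactic.FinCases
import HarnessLib

/-!
# `NoHeavyLowerTail` (crux stmt-CriticalPhenomena-4575), master-family line P2: `Sun 4` — classification of the normal-position co-singleton families and **the hierarchy theorem: all orders ⟺ the top row**

Support file (seat `prim-masterthm-p2`, gen 3; `--supports stmt-CriticalPhenomena-4575`); no named fact, no sorry.  Memo SAHI-ROUTE.md §4.12.
Part of the proof that on the sunflower poset `Sun 4` Sahi positivity of EVERY order is equivalent to the single top row `E_4(D_0,…,D_3) ≥ 0`: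
by the structure theorem (`…SahiSunflowerTower`) only the CO-SINGLETON families need a proof, and each satisfies an exact DOMINATION
IDENTITY `∏_{i=n−1}^{m−2}(i + a)·E_n(F) = E_m(row) + P`, `P` with nonnegative coefficients modulo `a + b + Σc = 1` (found and verified by two
independent programs, certs/domination_m4.json); replayed here in the KERNEL through prim-cert-2's reflection engine `…FaceCertKernel`
(`toPP/subCheckP/coeffsP`, `decide +kernel`) with the mass relation substituted symbolically (`SunCert.subst0`).
-/

namespace Summit.CriticalPhenomena.PercolationContinuityZ3.Theorems.SahiDeltaSystem
namespace Sun
open Lean.Grind.CommRing (Expr Context)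
open Finset Function Literature.Combinatorics.Sahi2008

set_option synthInstance.maxSize 16000 in
/-- **Classification** of the normal-position co-singleton families with 3 members (kernel check). [this work] -/
theorem classify4_3 : ∀ S0 : Finset (Fin 4), 0 ∉ S0 → 1 ∈ S0 → 2 ∈ S0 →
    ∀ S1 : Finset (Fin 4), 1 ∉ S1 → 0 ∈ S1 → 2 ∈ S1 →
    ∀ S2 : Finset (Fin 4), 2 ∉ S2 → 0 ∈ S2 → 1 ∈ S2 →
    ∃ e ∈ table4_3, S0 = e.S 0 ∧ S1 = e.S 1 ∧ S2 = e.S 2 := by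
  decide +kernel

set_option maxRecDepth 100000 in
/-- Every entry is the presentation it records (kernel check on index sets). [this work] -/
theorem table4_3_spec : ∀ e ∈ table4_3, ∀ j : Fin 3, e.S j = (rep4_3 e.t (sig4_3 e.s j)).map (rho4 e.r).toEmbedding := by
  decide +kernel

/-- The type certificates with 3 members, uniformly. [this work] -/
theorem cert4_3 {ν : Sun 4 → ℝ} (hν0 : ∀ x, 0 ≤ ν x) (hν1 : ∑ x, ν x = 1)
    (hrow : 0 ≤ sahiE ν 4 (fun i => setInd (U (Finset.univ.erase i)))) (t : Fin 4) :
    0 ≤ sahiE ν 3 (fun j => setInd (U (rep4_3 t j))) := by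
  have e : (fun j => setInd (U (rep4_3 t j))) = ![setInd (U (rep4_3 t 0)), setInd (U (rep4_3 t 1)), setInd (U (rep4_3 t 2))] := by
    funext j; fin_cases j <;> rfl
  rw [e]
  fin_cases t
  · exact co4_0 hν0 hν1 hrow rfl rfl rfl rfl rfl rfl
  · exact co4_1 hν0 hν1 hrow rfl rfl rfl rfl rfl rfl
  · exact co4_2 hν0 hν1 hrow rfl rfl rfl rfl rfl rfl
  · exact co4_3 hν0 hν1 hrow rfl rfl rfl rfl rfl rfl

/-- Normal-position co-singleton families with 3 members have `E_3 ≥ 0` under any weight with the top row. [this work] -/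
theorem normal4_3 {ν : Sun 4 → ℝ} (hν0 : ∀ x, 0 ≤ ν x) (hν1 : ∑ x, ν x = 1)
    (hrow : 0 ≤ sahiE ν 4 (fun i => setInd (U (Finset.univ.erase i)))) (S : Fin 3 → Finset (Fin 4))
    (h00 : (0 : Fin 4) ∉ S 0) (h01 : (1 : Fin 4) ∈ S 0) (h02 : (2 : Fin 4) ∈ S 0) (h11 : (1 : Fin 4) ∉ S 1) (h10 : (0 : Fin 4) ∈ S 1) (h12 : (2 : Fin 4) ∈ S 1) (h22 : (2 : Fin 4) ∉ S 2) (h20 : (0 : Fin 4) ∈ S 2) (h21 : (1 : Fin 4) ∈ S 2) :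
    0 ≤ sahiE ν 3 (fun j => setInd (U (S j))) := by
  obtain ⟨e, he, hS0, hS1, hS2⟩ := classify4_3 (S 0) h00 h01 h02 (S 1) h11 h10 h12 (S 2) h22 h20 h21
  have hS : ∀ j, S j = (rep4_3 e.t (sig4_3 e.s j)).map (rho4 e.r).toEmbedding := by
    intro j
    rw [← table4_3_spec e he j]
    fin_cases j
    · exact hS0
    · exact hS1
    · exact hS2
  rw [sahiE_transport ν (rho4 e.r) (sig4_3 e.s) (rep4_3 e.t) S hS]
  have hν0' : ∀ x, 0 ≤ (ν ∘ relabel (rho4 e.r)) x := fun x => hν0 _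
  have hν1' : ∑ x, (ν ∘ relabel (rho4 e.r)) x = 1 := by rw [sum_relabel]; exact hν1
  have hrow' : 0 ≤ sahiE (ν ∘ relabel (rho4 e.r)) 4 (fun i => setInd (U (Finset.univ.erase i))) := by
    rw [row_relabel]; exact hrow
  exact cert4_3 hν0' hν1' hrow' e.t

set_option synthInstance.maxSize 16000 in
/-- Normal position with 4 members forces the top row itself (kernel check). [this work] -/
theorem normal_row4 : ∀ S0 : Finset (Fin 4), 0 ∉ S0 → 1 ∈ S0 → 2 ∈ S0 → 3 ∈ S0 →
    ∀ S1 : Finset (Fin 4), 1 ∉ S1 → 0 ∈ S1 → 2 ∈ S1 → 3 ∈ S1 →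
    ∀ S2 : Finset (Fin 4), 2 ∉ S2 → 0 ∈ S2 → 1 ∈ S2 → 3 ∈ S2 →
    ∀ S3 : Finset (Fin 4), 3 ∉ S3 → 0 ∈ S3 → 1 ∈ S3 → 2 ∈ S3 →
    S0 = Finset.univ.erase 0 ∧ S1 = Finset.univ.erase 1 ∧ S2 = Finset.univ.erase 2 ∧ S3 = Finset.univ.erase 3 := by
  decide +kernel

/-- **Every normal-position co-singleton family of `Sun 4` is nonnegative** under every relabelled weight, given the top row. [this work] -/
theorem normal_nonneg4 {ν : Sun 4 → ℝ} (hν0 : ∀ x, 0 ≤ ν x) (hν1 : ∑ x, ν x = 1)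
    (hrow : 0 ≤ sahiE ν 4 (fun i => setInd (U (Finset.univ.erase i))))
    (π : Equiv.Perm (Fin 4)) (k : ℕ) (hk : k + 3 ≤ 4) (S : Fin (k + 3) → Finset (Fin 4))
    (h1 : ∀ i, Fin.castLE hk i ∉ S i) (h2 : ∀ i j, i ≠ j → Fin.castLE hk i ∈ S j) :
    0 ≤ sahiE (ν ∘ relabel π) (k + 3) (fun i => setInd (U (S i))) := by
  have hν0' : ∀ x, 0 ≤ (ν ∘ relabel π) x := fun x => hν0 _
  have hν1' : ∑ x, (ν ∘ relabel π) x = 1 := by rw [sum_relabel]; exact hν1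
  have hrow' : 0 ≤ sahiE (ν ∘ relabel π) 4 (fun i => setInd (U (Finset.univ.erase i))) := by rw [row_relabel]; exact hrow
  match k, hk, S, h1, h2 with
  | 0, hk, S, h1, h2 =>
    have h00 : (0 : Fin 4) ∉ S 0 := h1 0
    have h01 : (1 : Fin 4) ∈ S 0 := h2 1 0 (by decide)
    have h02 : (2 : Fin 4) ∈ S 0 := h2 2 0 (by decide)
    have h11 : (1 : Fin 4) ∉ S 1 := h1 1
    have h10 : (0 : Fin 4) ∈ S 1 := h2 0 1 (by decide)
    have h12 : (2 : Fin 4) ∈ S 1 := h2 2 1 (by decide)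
    have h22 : (2 : Fin 4) ∉ S 2 := h1 2
    have h20 : (0 : Fin 4) ∈ S 2 := h2 0 2 (by decide)
    have h21 : (1 : Fin 4) ∈ S 2 := h2 1 2 (by decide)
    exact normal4_3 hν0' hν1' hrow' S h00 h01 h02 h11 h10 h12 h22 h20 h21
  | 1, hk, S, h1, h2 =>
    have h00 : (0 : Fin 4) ∉ S 0 := h1 0
    have h01 : (1 : Fin 4) ∈ S 0 := h2 1 0 (by decide)
    have h02 : (2 : Fin 4) ∈ S 0 := h2 2 0 (by decide)
    have h03 : (3 : Fin 4) ∈ S 0 := h2 3 0 (by decide)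
    have h11 : (1 : Fin 4) ∉ S 1 := h1 1
    have h10 : (0 : Fin 4) ∈ S 1 := h2 0 1 (by decide)
    have h12 : (2 : Fin 4) ∈ S 1 := h2 2 1 (by decide)
    have h13 : (3 : Fin 4) ∈ S 1 := h2 3 1 (by decide)
    have h22 : (2 : Fin 4) ∉ S 2 := h1 2
    have h20 : (0 : Fin 4) ∈ S 2 := h2 0 2 (by decide)
    have h21 : (1 : Fin 4) ∈ S 2 := h2 1 2 (by decide)
    have h23 : (3 : Fin 4) ∈ S 2 := h2 3 2 (by decide)
    have h33 : (3 : Fin 4) ∉ S 3 := h1 3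
    have h30 : (0 : Fin 4) ∈ S 3 := h2 0 3 (by decide)
    have h31 : (1 : Fin 4) ∈ S 3 := h2 1 3 (by decide)
    have h32 : (2 : Fin 4) ∈ S 3 := h2 2 3 (by decide)
    obtain ⟨e0, e1, e2, e3⟩ := normal_row4 (S 0) h00 h01 h02 h03 (S 1) h11 h10 h12 h13 (S 2) h22 h20 h21 h23 (S 3) h33 h30 h31 h32
    have e : (fun i => setInd (U (S i))) = fun i : Fin 4 => setInd (U (Finset.univ.erase i)) := by
      funext i; fin_cases i
      · exact congrArg (fun s => setInd (U s)) e0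
      · exact congrArg (fun s => setInd (U s)) e1
      · exact congrArg (fun s => setInd (U s)) e2
      · exact congrArg (fun s => setInd (U s)) e3
    rw [e]; exact hrow'
  | k + 2, hk, _, _, _ => exact absurd hk (by omega)

/-- **THE `Sun 4` HIERARCHY THEOREM (sharp form).**  For every probability weight on the 4-petal sunflower poset: Sahi positivity of EVERY order
⟺ the single top row `E_4(χ_{U([4]∖0)}, …, χ_{U([4]∖3)}) ≥ 0`; the pair layer is implied (`e2_le_of_row4` + `sahiPositive_two_of_e2`) and every
other antichain family either has an absorbing member or is a co-singleton family dominated by the row. [this work] -/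
theorem sahiPositive_iff_row4 {ν : Sun 4 → ℝ} (hν0 : ∀ x, 0 ≤ ν x) (hν1 : ∑ x, ν x = 1) :
    (∀ n, SahiPositive ν n) ↔ 0 ≤ sahiE ν 4 (fun i => setInd (U (Finset.univ.erase i))) := by
  constructor
  · intro h
    exact (sahiPositive_iff_indicators ν 4).1 (h 4) (fun i => U (Finset.univ.erase i)) fun i => isUpperSet_U _
  · intro hrow n
    exact sahiPositive_of_two_of_normalCoSingleton hν0 hν1
      (sahiPositive_two_of_e2 hν0 hν1 (e2_le_of_row4 hν0 hν1 hrow rfl rfl rfl rfl rfl rfl))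
      (fun π k hk S h1 h2 => normal_nonneg4 hν0 hν1 hrow π k hk S h1 h2) n

end Sun
end Summit.CriticalPhenomena.PercolationContinuityZ3.Theorems.SahiDeltaSystem
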